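import Mathlib
import HarnessLib
import Summits.NavierStokesRegularity.NavierStokesRegularity.Theorems.HalfSpaceWindowDoorCirculationCarryingRigidityPlaneFluxConservation

/-!
# Route `HalfSpaceWindowDoor`, crux `CirculationCarryingRigidity` (stmt-NavierStokesRegularity-25311) — the CIRCULATION
# DICHOTOMY in the space–time Type-I subclass: poloidal, or carrying one positive conserved plane circulation

With the conserved plane circulation (`…PlaneFluxConservation`: `Φ(c₁,s₁) = Φ(c₂,s₂)` for closed-hemisphere profiles of the
route's class with space–time Type-I decay), the Liouville statement `HemisphereLiouvilleE3` restricted to that subclass becomes a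
statement about ONE number:

* `inner_curl_e3_eq_zero_of_planeFlux_eq_zero` — if the plane flux vanishes on one plane at one time, the profile is poloidal
  along `e₃` (`⟪curl v, e₃⟫ ≡ 0`): the flux vanishes on every plane at every time (conservation), and a continuous nonnegative
  function with zero integral vanishes;
* `planeFlux_pos_or_poloidal` — DICHOTOMY: either `⟪curl v, e₃⟫ ≡ 0`, or every plane at every negative time carries the same
  POSITIVE circulation `Φ₀ ∈ (0, 4πD]`.

So in this subclass the research stub reads: «no closed-hemisphere space–time Type-I profile carries a positive conserved plane
circulation» (the planner's v1 picture, critic P1, now kernel-exact).  Seat ns-hsw-p1 g2 (LEAD of 25311, cell pub-ns-dss).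
WHAT THIS IS NOT: not a statement about Navier–Stokes regularity; structure of HYPOTHETICAL blow-up profiles in a subclass;
helper `--supports` 25311.
-/

noncomputable section

-- the summit and its single sub-problem share the name (CONVENTIONS §1), as in every Theorems file
set_option linter.dupNamespace false

namespace Summit.NavierStokesRegularity.NavierStokesRegularity.Theorems.HalfSpaceWindowDoorCirculationCarryingRigidityPlaneFluxDichotomy

open MeasureTheory Set Function Filter Topology Metric
open scoped RealInnerProductSpace InnerProductSpace ENNReal
open Literature.Analysis Literature.Analysis.FluidPDE Literature.Analysis.UnboundedOperators
open Summit.NavierStokesRegularity.NavierStokesRegularity.Theorems.HalfSpaceWindowDoorCirculationCarryingRigidityDefs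
open Summit.NavierStokesRegularity.NavierStokesRegularity.Theorems.HalfSpaceWindowDoorCirculationCarryingRigidityWindowedFlux
  (continuous_planePt)
open Summit.NavierStokesRegularity.NavierStokesRegularity.Theorems.HalfSpaceWindowDoorCirculationCarryingRigidityPlaneFluxConservation
  (planeFlux_conserved_of_class_of_hasTypeIDecay)
open Summit.NavierStokesRegularity.NavierStokesRegularity.Theorems.LocalSineTubeDoorProfileAlignedWindowRigidityAncient
  (bdd_of_hasTypeITimeDecay analyticOnNhd_slice)

/-- Every point of `ℝ³` lies on a horizontal plane: `x = planePt (x 2) (x₀, x₁)`. -/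
theorem planePt_apply_two_eq (x : EuclideanSpace ℝ (Fin 3)) :
    planePt (x 2) (WithLp.toLp 2 ![x 0, x 1] : EuclideanSpace ℝ (Fin 2)) = x := by
  ext i
  fin_cases i <;> simp [planePt]

/-- **Zero circulation on one plane at one time forces a poloidal profile.**  For a closed-hemisphere profile of the route's
Type-I class with space–time Type-I decay: if `∫⁻_{ℝ²} ⟪curl v(s₀)(y,c₀), e₃⟫ dy = 0` for some `s₀ < 0` and height `c₀`, then
`⟪curl v(s)(x), e₃⟫ = 0` for all `s < 0` and all `x`. -/
theorem inner_curl_e3_eq_zero_of_planeFlux_eq_zero :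
    ∀ (C D : ℝ) (v : ℝ → EuclideanSpace ℝ (Fin 3) → EuclideanSpace ℝ (Fin 3)),
    Literature.Analysis.FluidPDE.HasTypeITimeDecay C v → Literature.Analysis.FluidPDE.HasTypeIDecay D v →
    ContinuousOn (Function.uncurry v) (Set.Iio (0 : ℝ) ×ˢ Set.univ) →
    (∀ s t : ℝ, s < t → t < 0 → ∀ x, v t x =
      Literature.Analysis.UnboundedOperators.heatExtension (v s) (t - s) x -
        Literature.Analysis.FluidPDE.oseenDuhamel 1 s v v t x) →
    (∀ t < 0, Literature.Analysis.FluidPDE.VectorCalculus.IsDivFree (v t)) →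
    (∀ s < 0, ∀ y, 0 ≤ ⟪Literature.Analysis.FluidPDE.curl (v s) y, e3⟫_ℝ) →
    ∀ s₀ < 0, ∀ c₀ : ℝ,
      ∫⁻ y, ENNReal.ofReal ⟪Literature.Analysis.FluidPDE.curl (v s₀) (planePt c₀ y), e3⟫_ℝ = 0 →
      ∀ s < 0, ∀ x, ⟪Literature.Analysis.FluidPDE.curl (v s) x, e3⟫_ℝ = 0 := by
  intro C D v hrate hdec hcont hmild hdiv hnn s₀ hs₀ c₀ hzero s hs x
  -- the flux vanishes on the plane through `x` at time `s`
  have hflux : ∫⁻ y, ENNReal.ofReal ⟪curl (v s) (planePt (x 2) y), e3⟫ = 0 := by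
    rw [planeFlux_conserved_of_class_of_hasTypeIDecay C D v hrate hdec hcont hmild hdiv hnn s hs s₀ hs₀ (x 2) c₀]
    exact hzero
  -- the integrand is continuous and nonnegative, hence identically zero
  have hA : AnalyticOnNhd ℝ (v s) univ := analyticOnNhd_slice hcont (bdd_of_hasTypeITimeDecay hrate) hmild hs
  have hV : ContDiff ℝ 2 (v s) := contDiff_iff_contDiffAt.2 fun z => (hA z (mem_univ z)).contDiffAt
  have hWc : Continuous (curl (v s)) := by
    rw [curl_eq_curlCLM_comp]
    exact curlCLM.continuous.comp (hV.continuous_fderiv two_ne_zero)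
  have hfc : Continuous fun y : EuclideanSpace ℝ (Fin 2) => ENNReal.ofReal ⟪curl (v s) (planePt (x 2) y), e3⟫ :=
    ENNReal.continuous_ofReal.comp ((hWc.comp (continuous_planePt _)).inner continuous_const)
  have hae : (fun y : EuclideanSpace ℝ (Fin 2) => ENNReal.ofReal ⟪curl (v s) (planePt (x 2) y), e3⟫) =ᵐ[volume] 0 :=
    (lintegral_eq_zero_iff hfc.measurable).1 hflux
  have hfun : (fun y : EuclideanSpace ℝ (Fin 2) => ENNReal.ofReal ⟪curl (v s) (planePt (x 2) y), e3⟫) = 0 :=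
    (Continuous.ae_eq_iff_eq volume hfc continuous_const).1 hae
  have hpt := congrFun hfun (WithLp.toLp 2 ![x 0, x 1])
  simp only [Pi.zero_apply, ENNReal.ofReal_eq_zero] at hpt
  rw [planePt_apply_two_eq] at hpt
  exact le_antisymm hpt (hnn s hs x)

/-- **CIRCULATION DICHOTOMY.**  A closed-hemisphere profile of the route's Type-I class with space–time Type-I decay is EITHER
poloidal along `e₃` (`⟪curl v, e₃⟫ ≡ 0`) OR carries on every horizontal plane at every negative time the same POSITIVE
circulation (`0 < ∫⁻_{ℝ²} ⟪curl v(s)(y,c), e₃⟫ dy`, one value for all `(c,s)`, `≤ 4πD`). -/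
theorem planeFlux_pos_or_poloidal :
    ∀ (C D : ℝ) (v : ℝ → EuclideanSpace ℝ (Fin 3) → EuclideanSpace ℝ (Fin 3)),
    Literature.Analysis.FluidPDE.HasTypeITimeDecay C v → Literature.Analysis.FluidPDE.HasTypeIDecay D v →
    ContinuousOn (Function.uncurry v) (Set.Iio (0 : ℝ) ×ˢ Set.univ) →
    (∀ s t : ℝ, s < t → t < 0 → ∀ x, v t x =
      Literature.Analysis.UnboundedOperators.heatExtension (v s) (t - s) x -
        Literature.Analysis.FluidPDE.oseenDuhamel 1 s v v t x) →
    (∀ t < 0, Literature.Analysis.FluidPDE.VectorCalculus.IsDivFree (v t)) →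
    (∀ s < 0, ∀ y, 0 ≤ ⟪Literature.Analysis.FluidPDE.curl (v s) y, e3⟫_ℝ) →
    (∀ s < 0, ∀ x, ⟪Literature.Analysis.FluidPDE.curl (v s) x, e3⟫_ℝ = 0) ∨
      (∀ s < 0, ∀ c : ℝ, 0 < ∫⁻ y, ENNReal.ofReal ⟪Literature.Analysis.FluidPDE.curl (v s) (planePt c y), e3⟫_ℝ) := by
  intro C D v hrate hdec hcont hmild hdiv hnn
  by_cases h : ∃ s₀ : ℝ, s₀ < 0 ∧ ∃ c₀ : ℝ, ∫⁻ y, ENNReal.ofReal ⟪curl (v s₀) (planePt c₀ y), e3⟫ = 0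
  · obtain ⟨s₀, hs₀, c₀, h0⟩ := h
    exact Or.inl (inner_curl_e3_eq_zero_of_planeFlux_eq_zero C D v hrate hdec hcont hmild hdiv hnn s₀ hs₀ c₀ h0)
  · push Not at h
    exact Or.inr fun s hs c => pos_iff_ne_zero.2 (h s hs c)

end Summit.NavierStokesRegularity.NavierStokesRegularity.Theorems.HalfSpaceWindowDoorCirculationCarryingRigidityPlaneFluxDichotomy

end
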